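import Literature.MathematicalPhysics.QuantumFieldTheory.Balaban1983to89.B1Eq31Concrete
import Literature.MathematicalPhysics.QuantumFieldTheory.Balaban1983to89.B4Thm110ZeroTorus

/-!
# `Balaban1983to89.B1Eq211ZeroFieldTorus` — T. Bałaban, *(Higgs)₂,₃ quantum fields in a finite volume. I. A lower bound*,
# Commun. Math. Phys. **85** (1982) 603–626 [Balaban1982Higgs1]: ONE lattice, TWO formalizations — the zero-field operators
# (2.11) `Q_k`, `Q_k^*`, (1.11)/(2.17) `−Δ^ε`, (2.20) `−Δ^ε + m² + a_k(L^kε)^{−2}P_k` OF THE (Higgs)₂,₃ MODEL (the typer's carrier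
# `HiggsLattice`/`HiggsCovariance`, external field `A = 0`, trivial coupling) ARE Bałaban's scalar torus tower `B1RG242Torus`
# (`Setup`'s tori), componentwise, on the sub-family of tori (1.2) with `M·L′_μ = L^m`

statement-level skeleton of published theorems with citation tags; proofs where landed; nothing here is a claim about the Yang–Mills mass gap

PDF held: `paper:balaban1982-cmp85-higgs23-i` (journal page = PDF page + 602); p. 604 [PDF 2] ((1.2)–(1.5)), p. 607 [PDF 5]
((1.17)–(1.21)), p. 608–610 [PDF 6–8] ((2.2), (2.11), (2.17), (2.20)); ×2 renders
`run/shared/lean/pub/pub-balaban/b2b-balaban-ref1/pages/1982-cmp85-higgs23-I/1982-cmp85-higgs23-I-p002|p005|p006|p007|p008-x2.png`.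

CITATION HEADER (lean-in-tree rule).  Cell `lit-balaban` (HOME `run/shared/lean/pub/lit-balaban/`), Phase-2 proof seat **p14**
gen 8 (unit `lit-balaban-p14`); KNITTING for SKELETON rows **B1.Eq1.2** (the tori), **B1.Eq2.10–2.11** (`Q_k`), **B1.Eq2.17**,
**B1.Eq2.20** (r14/r01) and the input (2.25) of **B1.Eq3.66–3.67** (r12; this seat's `B1Ineq367SmallField`, file 2 of this pair
`B1Ineq225ZeroFieldTorus`).  USED BY NAME, never restated: the typer's `HiggsLattice.{Params, Site, blockOf}`,
`HiggsAveraging.{blockIter, blockK}`, `HiggsCovariance.{avgQkLin, avgQkAdj, projPk, covLaplacianN, covOpK}`,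
`B3MultiscaleFields.{zeroCharge, qStar_apply}`, `B1Eq31Concrete.covLaplacianN_univ_apply`; pv07/p38's `Setup.{Params, Site,
blockOf}`, `Site.proj`, `B1RG242Torus.{tower, Qk, Qks, H, hOp, deriv, α, Qk_mulVec, Qks_mulVec, hOp_mulVec, deriv_mulVec}`,
`B5Display136Torus.{eq_shift_iff, shift_unshift}`.

WHAT IS PRINTED (verbatim).  p. 604 [PDF 2], (1.2): *"T_ε = {x ∈ εZ^d : −L_μ ≦ x_μ < L_μ, μ = 1, …, d}, where ε^{−1}L_μ = L^K M L′_μ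
and K, L, M, L′_μ are some positive integers"*; p. 608 [PDF 6]: *"The renormalization transformations for vector fields will be obtained
by taking N = d and an external vector field A = 0, so we will not consider them separately"*; p. 609 [PDF 7], (2.11): *"(Q_k(A)f)(y) =
L^{−kd}Σ_{x∈B^k(y)} U(A(Γ^{(k)}_{y,x}))f(x), y ∈ T^{(k)}_{L^kε}"*; p. 605 [PDF 3]: *"−Δ^ε_A = D^{ε*}_AD^ε_A is the covariant Laplace
operator and −Δ^ε = ∂^{ε*}∂^ε is the Laplace operator on the torus T_ε"*; p. 610 [PDF 8], (2.20): *"G^ε_k(Ω,A) = (−Δ^{ε,N}_{A,Ω} + m² +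
a_k(L^kε)^{−2}P_k(A))^{−1}, P_k(A) = Q^*_k(A)Q_k(A)"*.

THE TWO VOCABULARIES.  (H) the (Higgs)₂,₃ model line: `HiggsLattice.Site P k = Π_μ ZMod (2L^{K−k}ML′_μ)` (direction-dependent
periods, physical spacing `P.mesh k = L^kε`), fields `T^{(k)} → ℝ^N` (`EuclideanSpace`), operators as linear maps with the transports
`U(A(Γ))`; (S) the torus-analysis line of B4/B5/B2 (`Setup`): `Site P_S k = Fin d → ZMod (2L^{m+K−k})`, spacing `L^{k−K}` (unit
lattice at the top level), real-valued functions, operators as matrices, `U = 1`.  When `M·L′_μ = L^m` for every `μ` and `L` is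
odd, the level-`k` site counts agree for `k ≦ K` (`Shape.sitesPerDir_eq`) and the lattices are identified coordinatewise by
`ZMod.ringEquivCongr` (`eSite`); unit steps, blocks, `k`-fold blocks and block sums correspond (§1).  Reading an `ℝ^N`-valued field
component by component on the (S)-torus (`cmp`, §2), the model's zero-field operators are the (S)-matrices (§3): (2.11)
`avgQkLin_zero_apply`, its adjoint `avgQkAdj_zero_apply`, `P_k` `projPk_zero_apply`, the Laplacian `covLaplacianN_zero_apply`, and
the operator inverted in (2.20): **`covOpK_zero_apply`** — `(−Δ^ε + m² + a_K(L^Kε)^{−2}P_K)φ`, read on the (S)-torus, is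
`ℓ^{−2}·(H_S(m²ℓ²) + a_K·Q^*_KQ_K)` applied to the components, `ℓ = L^Kε` (the physical spacing `ε = ℓ·L^{−K}` against `Setup`'s
`L^{−K}`: the rescaling (1.22)/(2.22) to the unit lattice, done by bookkeeping of the prefactors).

WHAT THIS FILE PROVES (kernel-checked, zero `sorry`; new `def`s are transports/reindexings only — `Shape`, `Shape.toSetup`,
`eSite`, `cmp`; no `def … : Prop`, no new named fact; axioms standard): §1 `Shape.sitesPerDir_eq`, `val_eSite`, `eSite_shift`,
`eSite_unshift`, `eSite_blockOf`, `eSite_blockIter` (`x_k` of (2.2) = `Site.proj k k`), `sum_blockK_eq` (sums over `B^k(y)`),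
`mesh_zero_eq` (`ε = ℓ·L^{−K}`); §2 `cmp_apply`, `cmp_shift`/`cmp_unshift`; §3 `transpose_deriv_mulVec`, `hOp_mulVec_apply`
(`((−Δ^s + m²)f)(z) = m²f(z) + s^{−2}Σ_μ[(f(z) − f(z+e_μ)) + (f(z) − f(z−e_μ))]`), `covLaplacianN_zero_apply`,
`avgQkLin_zero_apply`, `avgQkAdj_zero_apply`, `projPk_zero_apply`, **`covOpK_zero_apply`**, `cmp_covOpK`.
HONEST SCOPE: zero external field and trivial coupling only (the vector-field case of p. 608); whole torus `Ω = T_ε`; the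
sub-family `M·L′_μ = L^m`, `L` odd, of (1.2) (`Setup`'s tori have equal periods `2L^{m+K−k}`, B12 (0.1)); levels `k ≦ K`.  Nothing
quantitative here (file 2 carries the propagator and the (2.25)-shaped bound).  Unit `lit-balaban-p14` gen 8 (…-p14-g8-0).
-/

open scoped BigOperators
open Matrix

namespace Literature.MathematicalPhysics.QuantumFieldTheory.Balaban1983to89.B1Eq211ZeroFieldTorus

open Literature.MathematicalPhysics.QuantumFieldTheory.Balaban1983to89.HiggsAveraging (blockIter blockK mem_blockK avgQk_apply)
open Literature.MathematicalPhysics.QuantumFieldTheory.Balaban1983to89.HiggsCovariance (covLaplacianN avgQkLin avgQkAdj projPk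
  covOpK avgQkLin_apply)
open Literature.MathematicalPhysics.QuantumFieldTheory.Balaban1983to89.B3MultiscaleFields (zeroCharge zeroCharge_U qStar_apply)
open Literature.MathematicalPhysics.QuantumFieldTheory.Balaban1983to89.B1Eq31Concrete (covLaplacianN_univ_apply)
open Literature.MathematicalPhysics.QuantumFieldTheory.Balaban1983to89.B1RG242Torus (tower Qk Qks H hOp shiftMat α lvl_of_le
  sitesPerDir_zero_eq sitesPerDir_eq_succ stepExp_of_lt Qk_mulVec Qks_mulVec hOp_mulVec deriv_mulVec)
open Literature.MathematicalPhysics.QuantumFieldTheory.Balaban1983to89.B5Display136Torus (eq_shift_iff shift_unshift)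

variable {P : HiggsLattice.Params}

/-! ## §1 The torus sub-family `M·L′_μ = L^m` of (1.2) and the carrier identification with `Setup`'s tori -/

/-- **The tori of (1.2) with equal periods a power of `L`**: `ε^{−1}L_μ = L^KML′_μ` with `M·L′_μ = L^m` for every direction and
`L` odd, `L > 1` — the sub-family on which `Setup`'s tori `T^{(k)} = (ℤ/2L^{m+K−k})^d` (B12 (0.1)) model B1's `T^{(k)}_{L^kε}`.
[cite: Balaban1982Higgs1, (1.2) p.604] -/
structure Shape (P : HiggsLattice.Params) where
  /-- the exponent with `M·L′_μ = L^m` -/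
  m : ℕ
  /-- `L` odd and `> 1` (`Setup.Params.hL`) -/
  hL : Odd P.L ∧ 1 < P.L
  /-- equal periods: `M·L′_μ = L^m` for every `μ` -/
  hM : ∀ μ : Fin P.d, P.M * P.Lp μ = P.L ^ m

namespace Shape

/-- The `Setup` parameters `(d, L, m, K)` of a torus of the sub-family. [cite: Balaban1982Higgs1, (1.2) p.604] -/
def toSetup (S : Shape P) : Params := ⟨P.d, P.L, S.m, P.K, P.hd, S.hL⟩

/-- `d` is the model's `d` ((1.2)). [cite: Balaban1982Higgs1, (1.2) p.604] -/
@[simp] theorem toSetup_d (S : Shape P) : S.toSetup.d = P.d := rfl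

/-- `L` is the model's `L` ((1.2)). [cite: Balaban1982Higgs1, (1.2) p.604] -/
@[simp] theorem toSetup_L (S : Shape P) : S.toSetup.L = P.L := rfl

/-- **The site counts agree**: `2L^{K−k}ML′_μ = 2L^{m+K−k}` for `k ≦ K` ((1.2) with (1.19)–(1.20) versus B12 (0.1)).
[cite: Balaban1982Higgs1, (1.20) p.607] -/
theorem sitesPerDir_eq (S : Shape P) {k : ℕ} (hk : k ≤ P.K) (μ : Fin P.d) :
    P.sitesPerDir k μ = S.toSetup.sitesPerDir k := by
  show 2 * (P.L ^ (P.K - k) * P.M * P.Lp μ) = 2 * P.L ^ (S.m + P.K - k)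
  rw [mul_assoc (P.L ^ (P.K - k)), S.hM μ, ← pow_add, Nat.add_sub_assoc hk, add_comm (P.K - k)]

/-- `Setup`'s fine spacing is `L^{−K}`; the model's is `ε = (L^Kε)·L^{−K}`. [cite: Balaban1982Higgs1, (1.19) p.607] -/
theorem mesh_zero_eq (S : Shape P) : P.mesh 0 = P.mesh P.K * S.toSetup.eps := by
  show (P.L : ℝ) ^ 0 * P.ε = (P.L : ℝ) ^ P.K * P.ε * (((P.L : ℝ)⁻¹) ^ P.K)
  have hL : (P.L : ℝ) ≠ 0 := by
    have := S.hL.2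
    exact_mod_cast (show P.L ≠ 0 by omega)
  rw [pow_zero, one_mul, inv_pow, mul_comm ((P.L : ℝ) ^ P.K) P.ε, mul_assoc, mul_inv_cancel₀ (pow_ne_zero _ hL), mul_one]

/-- `Setup`'s top spacing `L^K·L^{−K} = 1`: at the level `K` the (S)-lattice is the unit lattice. [cite: Balaban1982Higgs1, (2.22) p.610] -/
theorem spacing_K (S : Shape P) : S.toSetup.spacing P.K = 1 := S.toSetup.spacing_K

end Shape

/-- **THE CARRIER IDENTIFICATION `T^{(k)}_{L^kε} ≃ T^{(k)}`** (`k ≦ K`): coordinatewise `ZMod.ringEquivCongr` along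
`Shape.sitesPerDir_eq` (labels, unit steps and blocks preserved, below). [cite: Balaban1982Higgs1, (1.2) p.604] -/
def eSite (S : Shape P) {k : ℕ} (hk : k ≤ P.K) : HiggsLattice.Site P k ≃ Site S.toSetup k where
  toFun x := fun μ => ZMod.ringEquivCongr (S.sitesPerDir_eq hk μ) (x μ)
  invFun z := fun μ => (ZMod.ringEquivCongr (S.sitesPerDir_eq hk μ)).symm (z μ)
  left_inv x := funext fun μ => (ZMod.ringEquivCongr (S.sitesPerDir_eq hk μ)).symm_apply_apply (x μ)
  right_inv z := funext fun μ => (ZMod.ringEquivCongr (S.sitesPerDir_eq hk μ)).apply_symm_apply (z μ)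

section Carrier

variable (S : Shape P)

/-- Unfolding of `eSite` (the tori (1.2)). [cite: Balaban1982Higgs1, (1.2) p.604] -/
theorem eSite_apply {k : ℕ} (hk : k ≤ P.K) (x : HiggsLattice.Site P k) (μ : Fin P.d) :
    eSite S hk x μ = ZMod.ringEquivCongr (S.sitesPerDir_eq hk μ) (x μ) := rfl

/-- The identification preserves the integer labels of (1.2). [cite: Balaban1982Higgs1, (1.2) p.604] -/
theorem val_eSite {k : ℕ} (hk : k ≤ P.K) (x : HiggsLattice.Site P k) (μ : Fin P.d) :
    ((eSite S hk x) μ).val = (x μ).val := by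
  rw [eSite_apply]
  exact ZMod.ringEquivCongr_val _ _

/-- Unit steps forward correspond: `e(x + L^kεe_μ) = e(x) + e_μ`. [cite: Balaban1982Higgs1, (1.2) p.604] -/
theorem eSite_shift {k : ℕ} (hk : k ≤ P.K) (x : HiggsLattice.Site P k) (μ : Fin P.d) :
    eSite S hk (x.shift μ) = (eSite S hk x).shift μ := by
  funext ν
  by_cases h : ν = μ
  · subst h
    simp only [eSite_apply, HiggsLattice.Site.shift, Site.shift, Function.update_self, map_add, map_one]
  · have hx : Function.update x μ (x μ + 1) ν = x ν := Function.update_of_ne h _ _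
    simp only [eSite_apply, HiggsLattice.Site.shift, Site.shift, hx, Function.update_of_ne h]

/-- Unit steps backward correspond: `e(x − L^kεe_μ) = e(x) − e_μ`. [cite: Balaban1982Higgs1, (1.2) p.604] -/
theorem eSite_unshift {k : ℕ} (hk : k ≤ P.K) (x : HiggsLattice.Site P k) (μ : Fin P.d) :
    eSite S hk (x.unshift μ) = (eSite S hk x).unshift μ := by
  funext ν
  by_cases h : ν = μ
  · subst h
    simp only [eSite_apply, HiggsLattice.Site.unshift, Site.unshift, Function.update_self, map_sub, map_one]
  · have hx : Function.update x μ (x μ - 1) ν = x ν := Function.update_of_ne h _ _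
    simp only [eSite_apply, HiggsLattice.Site.unshift, Site.unshift, hx, Function.update_of_ne h]

/-- The inverse identification and forward steps on `T_ε` (1.2). [cite: Balaban1982Higgs1, (1.2) p.604] -/
theorem eSite_symm_shift {k : ℕ} (hk : k ≤ P.K) (z : Site S.toSetup k) (μ : Fin P.d) :
    (eSite S hk).symm (z.shift μ) = ((eSite S hk).symm z).shift μ := by
  rw [Equiv.symm_apply_eq, eSite_shift, Equiv.apply_symm_apply]

/-- The inverse identification and backward steps on `T_ε` (1.2). [cite: Balaban1982Higgs1, (1.2) p.604] -/
theorem eSite_symm_unshift {k : ℕ} (hk : k ≤ P.K) (z : Site S.toSetup k) (μ : Fin P.d) :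
    (eSite S hk).symm (z.unshift μ) = ((eSite S hk).symm z).unshift μ := by
  rw [Equiv.symm_apply_eq, eSite_unshift, Equiv.apply_symm_apply]

/-- **Blocks correspond** ((1.17): `x ∈ B(y)` iff `y = ⌊x/L⌋` coordinatewise in labels, in both vocabularies).
[cite: Balaban1982Higgs1, (1.17) p.606] -/
theorem eSite_blockOf {k : ℕ} (hk : k + 1 ≤ P.K) (x : HiggsLattice.Site P k) :
    eSite S hk (HiggsLattice.blockOf x) = blockOf (eSite S (Nat.le_of_succ_le hk) x) := by
  funext μ
  rw [eSite_apply]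
  show ZMod.ringEquivCongr _ ((((x μ).val / P.L : ℕ)) : ZMod (P.sitesPerDir (k + 1) μ))
    = ((((eSite S (Nat.le_of_succ_le hk) x) μ).val / S.toSetup.L : ℕ) : ZMod (S.toSetup.sitesPerDir (k + 1)))
  rw [map_natCast, val_eSite]
  rfl

/-- **The `k`-fold block point `x_k` of (2.2) is `Setup`'s `k`-fold block map** `Site.proj k k` (`x ∈ B^k(x_k)`).
[cite: Balaban1982Higgs1, (2.2) p.608] -/
theorem eSite_blockIter {k : ℕ} (hk : k ≤ P.K) (x : HiggsLattice.Site P 0) :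
    eSite S hk (blockIter k x) = Site.proj k k (eSite S (Nat.zero_le _) x) := by
  induction k with
  | zero =>
      rw [Site.proj_zero]
      rfl
  | succ k ih =>
      have hk' : k ≤ P.K := Nat.le_of_succ_le hk
      have hkm : k ≤ S.toSetup.m + S.toSetup.K := hk'.trans (Nat.le_add_left _ _)
      have hkm1 : k + 1 ≤ S.toSetup.m + S.toSetup.K := hk.trans (Nat.le_add_left _ _)
      have h0 : S.toSetup.sitesPerDir 0 = S.toSetup.L ^ k * S.toSetup.sitesPerDir k := by
        rw [sitesPerDir_zero_eq S.toSetup k, lvl_of_le S.toSetup hkm]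
      have h1 : S.toSetup.sitesPerDir k = S.toSetup.L ^ 1 * S.toSetup.sitesPerDir (k + 1) := by
        rw [sitesPerDir_eq_succ S.toSetup k, stepExp_of_lt S.toSetup hkm1]
      show eSite S hk (HiggsLattice.blockOf (blockIter k x)) = _
      rw [eSite_blockOf S hk, ih hk', ← Site.proj_one_eq_blockOf, Site.proj_comp h0 h1]

/-- Membership in the `k`-fold block read through the identification. [cite: Balaban1982Higgs1, (1.20) p.607] -/
theorem blockIter_eq_iff {k : ℕ} (hk : k ≤ P.K) (x : HiggsLattice.Site P 0) (y : HiggsLattice.Site P k) :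
    blockIter k x = y ↔ Site.proj k k (eSite S (Nat.zero_le _) x) = eSite S hk y := by
  rw [← eSite_blockIter S hk, (eSite S hk).apply_eq_iff_eq]

/-- **Sums over the `k`-fold block `B^k(y)` correspond** (the sums in (2.11)). [cite: Balaban1982Higgs1, (2.11) p.609] -/
theorem sum_blockK_eq {M : Type*} [AddCommMonoid M] {k : ℕ} (hk : k ≤ P.K) (y : HiggsLattice.Site P k)
    (F : HiggsLattice.Site P 0 → M) :
    ∑ x ∈ blockK k y, F x
      = ∑ z ∈ Finset.univ.filter (fun z : Site S.toSetup 0 => Site.proj k k z = eSite S hk y),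
          F ((eSite S (Nat.zero_le _)).symm z) := by
  refine Finset.sum_equiv (eSite S (Nat.zero_le _)) (fun x => ?_) (fun x _ => by rw [Equiv.symm_apply_apply])
  simp only [mem_blockK, Finset.mem_filter, Finset.mem_univ, true_and, blockIter_eq_iff S hk]

end Carrier

/-! ## §2 Reading an `ℝ^N`-valued field component by component on the (S)-torus -/

section Components

variable (S : Shape P) {N : ℕ}

/-- **The `i`-th component of a field on `T_ε`, read on `Setup`'s torus**: `(cmp_i φ)(z) = φ(e⁻¹z)_i` (linear). The vector
case `N = d` is p. 608's *"taking N = d and an external vector field A = 0"*. [cite: Balaban1982Higgs1, (1.5) p.604] -/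
def cmp (i : Fin N) : HiggsLattice.ScalarField P 0 N →ₗ[ℝ] (Site S.toSetup 0 → ℝ) where
  toFun φ := fun z => φ ((eSite S (Nat.zero_le _)).symm z) i
  map_add' φ ψ := by
    funext z
    simp only [Pi.add_apply, PiLp.add_apply]
  map_smul' c φ := by
    funext z
    simp only [Pi.smul_apply, PiLp.smul_apply, smul_eq_mul, RingHom.id_apply]

/-- Unfolding of `cmp` (fields on `T_ε`, (1.5)). [cite: Balaban1982Higgs1, (1.5) p.604] -/
@[simp] theorem cmp_apply (i : Fin N) (φ : HiggsLattice.ScalarField P 0 N) (z : Site S.toSetup 0) :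
    cmp S i φ z = φ ((eSite S (Nat.zero_le _)).symm z) i := rfl

/-- `cmp` at an identified site ((1.5)). [cite: Balaban1982Higgs1, (1.5) p.604] -/
theorem cmp_apply_eSite (i : Fin N) (φ : HiggsLattice.ScalarField P 0 N) (x : HiggsLattice.Site P 0) :
    cmp S i φ (eSite S (Nat.zero_le _) x) = φ x i := by
  rw [cmp_apply, Equiv.symm_apply_apply]

/-- `cmp` and forward steps ((1.2), (1.5)). [cite: Balaban1982Higgs1, (1.5) p.604] -/
theorem cmp_shift (i : Fin N) (φ : HiggsLattice.ScalarField P 0 N) (x : HiggsLattice.Site P 0) (μ : Fin P.d) :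
    cmp S i φ ((eSite S (Nat.zero_le _) x).shift μ) = φ (x.shift μ) i := by
  rw [cmp_apply, eSite_symm_shift, Equiv.symm_apply_apply]

/-- `cmp` and backward steps ((1.2), (1.5)). [cite: Balaban1982Higgs1, (1.5) p.604] -/
theorem cmp_unshift (i : Fin N) (φ : HiggsLattice.ScalarField P 0 N) (x : HiggsLattice.Site P 0) (μ : Fin P.d) :
    cmp S i φ ((eSite S (Nat.zero_le _) x).unshift μ) = φ (x.unshift μ) i := by
  rw [cmp_apply, eSite_symm_unshift, Equiv.symm_apply_apply]

/-- A field on `T_ε` ((1.5)) is determined by its components on the (S)-torus. [cite: Balaban1982Higgs1, (1.5) p.604] -/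
theorem eq_of_cmp_eq {φ ψ : HiggsLattice.ScalarField P 0 N} (h : ∀ i, cmp S i φ = cmp S i ψ) : φ = ψ := by
  funext x
  refine PiLp.ext fun i => ?_
  have := congrFun (h i) (eSite S (Nat.zero_le _) x)
  rwa [cmp_apply_eSite, cmp_apply_eSite] at this

end Components

/-! ## §3 The zero-field dictionaries: (2.11), `Q_k^*`, `P_k`, (1.11)/(2.17), and the operator of (2.20) -/

section LaplacianS

variable {Q : Params} {i : ℕ}

/-- The transpose of the forward difference is minus the backward difference: `((∂^s_μ)ᵀg)(z) = s^{−1}(g(z − e_μ) − g(z))`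
((1.4)–(1.5): the (1.5)-adjoint of `∂^ε` up to the common weight). [cite: Balaban1982Higgs1, (1.4) p.604] -/
theorem transpose_deriv_mulVec (s : ℝ) (μ : Fin Q.d) (g : Site Q i → ℝ) (z : Site Q i) :
    ((B1RG242Torus.deriv Q i s μ)ᵀ *ᵥ g) z = s⁻¹ * (g (z.unshift μ) - g z) := by
  simp only [Matrix.mulVec, dotProduct, Matrix.transpose_apply, B1RG242Torus.deriv, shiftMat, Matrix.smul_apply,
    Matrix.sub_apply, Matrix.one_apply, smul_eq_mul]
  simp_rw [eq_shift_iff z _ μ]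
  rw [show (∑ x : Site Q i, s⁻¹ * ((if x = z.unshift μ then (1 : ℝ) else 0) - (if x = z then 1 else 0)) * g x)
      = ∑ x : Site Q i, (s⁻¹ * ((if x = z.unshift μ then (1 : ℝ) else 0) * g x)
          - s⁻¹ * ((if x = z then (1 : ℝ) else 0) * g x)) from Finset.sum_congr rfl fun x _ => by ring]
  rw [Finset.sum_sub_distrib, ← Finset.mul_sum, ← Finset.mul_sum]
  simp_rw [ite_mul, one_mul, zero_mul]
  rw [Finset.sum_ite_eq' Finset.univ (z.unshift μ), if_pos (Finset.mem_univ _), Finset.sum_ite_eq' Finset.univ z,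
    if_pos (Finset.mem_univ _), mul_sub]

/-- **`−Δ^s + m²` pointwise**: `((−Δ^s + m²)f)(z) = m²f(z) + s^{−2}Σ_μ[(f(z) − f(z + se_μ)) + (f(z) − f(z − se_μ))]` (p. 605:
`−Δ^ε = ∂^{ε*}∂^ε`). [cite: Balaban1982Higgs1, (1.11) p.605] -/
theorem hOp_mulVec_apply (s msq : ℝ) (f : Site Q i → ℝ) (z : Site Q i) :
    (hOp Q i s msq *ᵥ f) z
      = msq * f z + (s⁻¹) ^ 2 * ∑ μ : Fin Q.d, ((f z - f (z.shift μ)) + (f z - f (z.unshift μ))) := by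
  rw [hOp_mulVec, Pi.add_apply, Pi.smul_apply, smul_eq_mul, Finset.sum_apply, Finset.mul_sum]
  congr 1
  refine Finset.sum_congr rfl fun μ _ => ?_
  rw [transpose_deriv_mulVec, deriv_mulVec, deriv_mulVec, shift_unshift]
  ring

end LaplacianS

section Dictionary

variable (S : Shape P)

/-- `hOp_mulVec_apply` on the torus of a shape, the direction sum indexed by the model's `Fin d`. [cite: Balaban1982Higgs1, (1.11) p.605] -/
theorem hOp_toSetup_mulVec_apply (s msq : ℝ) (f : Site S.toSetup 0 → ℝ) (z : Site S.toSetup 0) :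
    (hOp S.toSetup 0 s msq *ᵥ f) z
      = msq * f z + (s⁻¹) ^ 2 * ∑ μ : Fin P.d, ((f z - f (z.shift μ)) + (f z - f (z.unshift μ))) :=
  hOp_mulVec_apply s msq f z

/-- **(1.11)/(2.17) at zero field IS `Setup`'s `−Δ`**: the `i`-th component of `(−Δ^ε φ)(x)` (covariant Laplacian of the model
at the trivial coupling, `A = 0`, whole torus) is `ε^{−2}Σ_μ[(φ_i(x) − φ_i(x+εe_μ)) + (φ_i(x) − φ_i(x−εe_μ))]`, i.e. the matrix
`Σ_μ(∂^{η}_μ)ᵀ∂^{η}_μ` of `B1RG242Torus` on the component `cmp_i φ` up to the spacing bookkeeping `ε = ℓη`, `ℓ = L^Kε`, `η = L^{−K}`.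
[cite: Balaban1982Higgs1, (2.17) p.610] -/
theorem covLaplacianN_zero_apply (φ : HiggsLattice.ScalarField P 0 P.d) (x : HiggsLattice.Site P 0) (i : Fin P.d) :
    (covLaplacianN (zeroCharge P.d) Finset.univ (0 : HiggsLattice.VecField P 0) φ x) i
      = ((P.mesh 0)⁻¹) ^ 2 * ∑ μ : Fin P.d,
          ((cmp S i φ (eSite S (Nat.zero_le _) x) - cmp S i φ ((eSite S (Nat.zero_le _) x).shift μ))
            + (cmp S i φ (eSite S (Nat.zero_le _) x) - cmp S i φ ((eSite S (Nat.zero_le _) x).unshift μ))) := by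
  rw [covLaplacianN_univ_apply]
  simp only [zeroCharge_U, one_apply_eq_self, PiLp.smul_apply, smul_eq_mul, WithLp.ofLp_sum,
    Finset.sum_apply, WithLp.ofLp_add, WithLp.ofLp_sub, Pi.add_apply, Pi.sub_apply, cmp_apply_eSite, cmp_shift, cmp_unshift]

/-- **(2.11) at zero field IS `Setup`'s `Q_k`** (`k ≦ K`): `(Q_kf)(y)_i = L^{−kd}Σ_{x∈B^k(y)}f_i(x) = (Q_k cmp_i f)(e y)`.
[cite: Balaban1982Higgs1, (2.11) p.609] -/
theorem avgQkLin_zero_apply (a msq : ℝ) {k : ℕ} (hk : k ≤ P.K) (f : HiggsLattice.ScalarField P 0 P.d)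
    (y : HiggsLattice.Site P k) (i : Fin P.d) :
    (avgQkLin (zeroCharge P.d) (0 : HiggsLattice.VecField P 0) k f y) i
      = ((tower S.toSetup a msq).Qk k *ᵥ cmp S i f) (eSite S hk y) := by
  have hkm : k ≤ S.toSetup.m + S.toSetup.K := hk.trans (Nat.le_add_left _ _)
  rw [avgQkLin_apply, avgQk_apply, Qk_mulVec a msq hkm]
  simp only [zeroCharge_U, one_apply_eq_self, PiLp.smul_apply, smul_eq_mul, WithLp.ofLp_sum,
    Finset.sum_apply]
  rw [sum_blockK_eq S hk y (fun x => (f x) i)]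
  simp only [cmp_apply, Shape.toSetup_L, Shape.toSetup_d]
  congr 1
  rw [inv_pow, ← pow_mul, mul_comm P.d k]

/-- **`Q_k^*` at zero field IS `Setup`'s `Q^*_k`** (`k ≦ K`): `(Q_k^*g)(x)_i = g_i(x_k) = (Q^*_k g̃_i)(e x)` with `g̃_i` the `i`-th
component of `g` read on `T^{(k)}`. [cite: Balaban1982Higgs1, (2.20) p.610] -/
theorem avgQkAdj_zero_apply (a msq : ℝ) {k : ℕ} (hk : k ≤ P.K) (g : HiggsLattice.ScalarField P k P.d)
    (x : HiggsLattice.Site P 0) (i : Fin P.d) :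
    (avgQkAdj (zeroCharge P.d) (0 : HiggsLattice.VecField P 0) k g x) i
      = ((tower S.toSetup a msq).Qks k *ᵥ fun w => g ((eSite S hk).symm w) i) (eSite S (Nat.zero_le _) x) := by
  have hkm : k ≤ S.toSetup.m + S.toSetup.K := hk.trans (Nat.le_add_left _ _)
  rw [qStar_apply, Qks_mulVec a msq hkm, ← eSite_blockIter S hk, Equiv.symm_apply_apply]

/-- **`P_k = Q_k^*Q_k` at zero field IS `Setup`'s `Q^*_kQ_k`** (`k ≦ K`), componentwise. [cite: Balaban1982Higgs1, (2.20) p.610] -/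
theorem projPk_zero_apply (a msq : ℝ) {k : ℕ} (hk : k ≤ P.K) (φ : HiggsLattice.ScalarField P 0 P.d)
    (x : HiggsLattice.Site P 0) (i : Fin P.d) :
    (projPk (zeroCharge P.d) (0 : HiggsLattice.VecField P 0) k φ x) i
      = (((tower S.toSetup a msq).Qks k * (tower S.toSetup a msq).Qk k) *ᵥ cmp S i φ) (eSite S (Nat.zero_le _) x) := by
  rw [← Matrix.mulVec_mulVec, projPk, LinearMap.comp_apply, avgQkAdj_zero_apply S a msq hk]
  congr 2
  funext w
  rw [← Equiv.apply_symm_apply (eSite S hk) w, avgQkLin_zero_apply S a msq hk, Equiv.symm_apply_apply,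
    Equiv.apply_symm_apply]

/-- **THE OPERATOR OF (2.20) AT ZERO FIELD, READ ON `Setup`'S TORUS**: for `1 ≦ K` (so that the top level is `Setup`'s unit
lattice) the `i`-th component of `(−Δ^ε + m² + a_K(L^Kε)^{−2}P_K)φ` at `x` equals
`ℓ^{−2}·((H_S(m²ℓ²) + a_K·Q^*_KQ_K) cmp_i φ)(e x)`, `ℓ = L^Kε`, where `H_S(m²ℓ²) = −Δ^{η} + m²ℓ²` and `a_K = α_K` are the
top-level data of Bałaban's scalar torus tower `B1RG242Torus.tower P_S a (m²ℓ²)` (its `G K` is the inverse, (2.20) = B4 (1.6) on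
the unit lattice: the rescaling (2.22)). [cite: Balaban1982Higgs1, (2.20) p.610; (2.22) p.610] -/
theorem covOpK_zero_apply (msq a : ℝ) (φ : HiggsLattice.ScalarField P 0 P.d) (x : HiggsLattice.Site P 0) (i : Fin P.d) :
    (covOpK (zeroCharge P.d) Finset.univ (0 : HiggsLattice.VecField P 0) msq a P.K φ x) i
      = (P.mesh P.K ^ 2)⁻¹ *
          ((H S.toSetup (msq * P.mesh P.K ^ 2) + α S.toSetup a P.K • (Qks S.toSetup P.K * Qk S.toSetup P.K))
            *ᵥ cmp S i φ) (eSite S (Nat.zero_le _) x) := by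
  have hℓ : P.mesh P.K ≠ 0 := (P.mesh_pos P.K).ne'
  have hℓ2 : P.mesh P.K ^ 2 ≠ 0 := pow_ne_zero 2 hℓ
  -- the left side, term by term
  have hL : (covOpK (zeroCharge P.d) Finset.univ (0 : HiggsLattice.VecField P 0) msq a P.K φ x) i
      = (covLaplacianN (zeroCharge P.d) Finset.univ (0 : HiggsLattice.VecField P 0) φ x) i + msq * φ x i
        + B1.aSeq a P.L P.K * ((P.mesh P.K)⁻¹ ^ 2) * (projPk (zeroCharge P.d) (0 : HiggsLattice.VecField P 0) P.K φ x) i := by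
    simp only [covOpK, LinearMap.add_apply, LinearMap.smul_apply, LinearMap.id_apply, Pi.add_apply, Pi.smul_apply,
      PiLp.add_apply, PiLp.smul_apply, smul_eq_mul]
  -- the right side, term by term
  have hR : ((H S.toSetup (msq * P.mesh P.K ^ 2) + α S.toSetup a P.K • (Qks S.toSetup P.K * Qk S.toSetup P.K))
        *ᵥ cmp S i φ) (eSite S (Nat.zero_le _) x)
      = (hOp S.toSetup 0 S.toSetup.eps (msq * P.mesh P.K ^ 2) *ᵥ cmp S i φ) (eSite S (Nat.zero_le _) x)
        + α S.toSetup a P.K * (((tower S.toSetup a msq).Qks P.K * (tower S.toSetup a msq).Qk P.K) *ᵥ cmp S i φ)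
            (eSite S (Nat.zero_le _) x) := by
    rw [Matrix.add_mulVec, Matrix.smul_mulVec, Pi.add_apply, Pi.smul_apply, smul_eq_mul]
    rfl
  have hα : α S.toSetup a P.K = B1.aSeq a P.L P.K := by
    show B1.aSeq a S.toSetup.L P.K * (S.toSetup.spacing P.K ^ 2)⁻¹ = _
    rw [S.spacing_K, one_pow, inv_one, mul_one, Shape.toSetup_L]
  have hε : (P.mesh 0)⁻¹ ^ 2 = (P.mesh P.K ^ 2)⁻¹ * (S.toSetup.eps⁻¹) ^ 2 := by
    rw [S.mesh_zero_eq, mul_inv, mul_pow, inv_pow]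
  rw [hL, hR, covLaplacianN_zero_apply S, hOp_toSetup_mulVec_apply, ← projPk_zero_apply S a msq le_rfl, hα, hε,
    cmp_apply_eSite]
  field_simp
  ring

/-- The same dictionary as an identity of functions on `Setup`'s torus: `cmp_i((2.20)-operator φ) = ℓ^{−2}·(H_S + a_KQ^*_KQ_K)cmp_iφ`.
[cite: Balaban1982Higgs1, (2.20) p.610] -/
theorem cmp_covOpK (msq a : ℝ) (φ : HiggsLattice.ScalarField P 0 P.d) (i : Fin P.d) :
    cmp S i (covOpK (zeroCharge P.d) Finset.univ (0 : HiggsLattice.VecField P 0) msq a P.K φ)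
      = (P.mesh P.K ^ 2)⁻¹ •
          ((H S.toSetup (msq * P.mesh P.K ^ 2) + α S.toSetup a P.K • (Qks S.toSetup P.K * Qk S.toSetup P.K))
            *ᵥ cmp S i φ) := by
  funext z
  rw [Pi.smul_apply, smul_eq_mul, ← Equiv.apply_symm_apply (eSite S (Nat.zero_le _)) z, cmp_apply_eSite,
    covOpK_zero_apply S, Equiv.apply_symm_apply]

end Dictionary

end Literature.MathematicalPhysics.QuantumFieldTheory.Balaban1983to89.B1Eq211ZeroFieldTorus
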